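import Mathlib.Analysis.Calculus.IteratedDeriv.Lemmas
import Mathlib.Analysis.SpecialFunctions.Trigonometric.Basic
import Mathlib.Topology.Algebra.Order.LiminfLimsup

/-!
# drefute `stmt-AtomisticToContinuum-12597` / line `temperature-blind-vitali-hurwitz`
# Tightness of `stub_realVitali`: the SMOOTHNESS clause is load-bearing

`stub_realVitali` assumes, besides the ν-uniform factorial bounds on `iteratedDeriv k (g ν)` (k ≥ 1)
and corner convergence, the clause `∀ ν k, DifferentiableOn ℝ (iteratedDeriv k (g ν)) (Ioi 0)`
(fed by the first clause of `stub_logGevreyTower`). This file proves that WITHOUT that clause the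
statement is FALSE: Mathlib's `deriv` is `0` at non-differentiable points, so a step function has
`deriv ≡ 0` and all `iteratedDeriv k = 0` (k ≥ 1) — every factorial bound holds by junk — while
`g ν T := sin (ν⁻¹) · 𝟙{T > 1}` converges (to 0) on the corner `(0, 1)` and has no limit at `T = 2`.
Consequence for the lead: the `C^∞` clause of `stub_logGevreyTower` (genuine smoothness of
`T ↦ log A_T(ν)` on `(0,∞)`) must really be proved; bounds on formal `iteratedDeriv`s are worthless
without it. (Sorry-free; Mathlib only.)
-/

noncomputable section

namespace Summit.AtomisticToContinuum.FouriersLaw.Cruxes.GreenKuboContinuation.Drefute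

open Filter Topology Set

/-- The unit step at `1`. -/
def stepFun (x : ℝ) : ℝ := if x ≤ 1 then 0 else 1

theorem deriv_stepFun (x : ℝ) : deriv stepFun x = 0 := by
  rcases lt_trichotomy x 1 with hx | rfl | hx
  · have h : stepFun =ᶠ[𝓝 x] fun _ => (0:ℝ) := by
      filter_upwards [Iio_mem_nhds hx] with y hy
      simp [stepFun, (mem_Iio.1 hy).le]
    rw [h.deriv_eq, deriv_const]
  · apply deriv_zero_of_not_differentiableAt
    intro hd
    have h1 : Tendsto stepFun (𝓝[>] (1:ℝ)) (𝓝 (stepFun 1)) :=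
      hd.continuousAt.tendsto.mono_left nhdsWithin_le_nhds
    have h2 : Tendsto stepFun (𝓝[>] (1:ℝ)) (𝓝 1) := by
      refine (tendsto_const_nhds (x := (1:ℝ))).congr' ?_
      filter_upwards [self_mem_nhdsWithin] with y hy
      simp [stepFun, not_le.2 (mem_Ioi.1 hy)]
    have h3 := tendsto_nhds_unique h1 h2
    simp [stepFun] at h3
  · have h : stepFun =ᶠ[𝓝 x] fun _ => (1:ℝ) := by
      filter_upwards [Ioi_mem_nhds hx] with y hy
      simp [stepFun, not_le.2 (mem_Ioi.1 hy)]
    rw [h.deriv_eq, deriv_const]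

/-- All formal iterated derivatives of order `≥ 1` of the step function vanish identically. -/
theorem iteratedDeriv_stepFun {k : ℕ} (hk : 1 ≤ k) (x : ℝ) : iteratedDeriv k stepFun x = 0 := by
  obtain ⟨m, rfl⟩ : ∃ m, k = m + 1 := ⟨k - 1, by omega⟩
  rw [iteratedDeriv_succ']
  have h : deriv stepFun = fun _ => (0:ℝ) := funext deriv_stepFun
  rw [h]
  exact iteratedDeriv_fun_const_zero

/-- `sin (ν⁻¹)` has no limit as `ν ↓ 0`. -/
theorem not_tendsto_sin_inv :
    ¬ ∃ L : ℝ, Tendsto (fun ν : ℝ => Real.sin ν⁻¹) (𝓝[>] 0) (𝓝 L) := by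
  rintro ⟨L, hL⟩
  -- two sequences tending to 0⁺ along which sin ν⁻¹ is 1, resp. -1
  have hlin : Tendsto (fun n : ℕ => (n : ℝ) * (2 * Real.pi)) atTop atTop :=
    tendsto_natCast_atTop_atTop.atTop_mul_const (by positivity)
  have hu : Tendsto (fun n : ℕ => (Real.pi / 2 + n * (2 * Real.pi))⁻¹) atTop (𝓝[>] (0:ℝ)) := by
    refine tendsto_nhdsWithin_iff.2 ⟨?_, Eventually.of_forall fun n => ?_⟩
    · exact (tendsto_inv_atTop_zero : Tendsto (fun r : ℝ => r⁻¹) atTop (𝓝 0)).comp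
        (tendsto_atTop_add_const_left atTop _ hlin)
    · exact mem_Ioi.2 (inv_pos.2 (by positivity))
  have hv : Tendsto (fun n : ℕ => (-(Real.pi / 2) + (n + 1 : ℕ) * (2 * Real.pi))⁻¹) atTop
      (𝓝[>] (0:ℝ)) := by
    refine tendsto_nhdsWithin_iff.2 ⟨?_, Eventually.of_forall fun n => ?_⟩
    · refine (tendsto_inv_atTop_zero : Tendsto (fun r : ℝ => r⁻¹) atTop (𝓝 0)).comp
        (tendsto_atTop_add_const_left atTop _ ?_)
      exact hlin.comp (tendsto_add_atTop_nat 1)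
    · have : (0:ℝ) < -(Real.pi / 2) + (n + 1 : ℕ) * (2 * Real.pi) := by
        have hn : (1:ℝ) ≤ ((n + 1 : ℕ) : ℝ) := by exact_mod_cast Nat.succ_le_succ (Nat.zero_le n)
        nlinarith [Real.pi_pos]
      exact mem_Ioi.2 (inv_pos.2 this)
  have h1 : Tendsto (fun n : ℕ => Real.sin ((Real.pi / 2 + n * (2 * Real.pi))⁻¹)⁻¹) atTop (𝓝 L) :=
    hL.comp hu
  have h2 : Tendsto (fun n : ℕ => Real.sin ((-(Real.pi / 2) + (n + 1 : ℕ) * (2 * Real.pi))⁻¹)⁻¹)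
      atTop (𝓝 L) := hL.comp hv
  simp only [inv_inv, Real.sin_add_nat_mul_two_pi, Real.sin_pi_div_two, Real.sin_neg] at h1 h2
  have e1 : L = 1 := tendsto_nhds_unique h1 tendsto_const_nhds |>.symm ▸ rfl
  have e2 : (-1 : ℝ) = L := tendsto_nhds_unique tendsto_const_nhds h2
  linarith

/-- **`stub_realVitali` IS FALSE WITHOUT ITS SMOOTHNESS CLAUSE** (any proof must use
`DifferentiableOn ℝ (iteratedDeriv k (g ν)) (Ioi 0)`; equivalently the `C^∞` clause of
`stub_logGevreyTower` is load-bearing): witness `g ν T := sin (ν⁻¹) • 𝟙{T > 1}`, `T₀ = 1`. -/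
theorem realVitali_false_without_smoothness :
    ¬ (∀ (g : ℝ → ℝ → ℝ) (T₀ : ℝ), 0 < T₀ →
      (∀ a b : ℝ, 0 < a → a < b → ∃ C : ℝ, 0 < C ∧ ∀ ν : ℝ, 0 < ν → ν ≤ 1 →
        ∀ k : ℕ, 1 ≤ k → ∀ T ∈ Set.Icc a b,
          |iteratedDeriv k (g ν) T| ≤ C ^ (k + 1) * (k.factorial : ℝ)) →
      (∀ T : ℝ, 0 < T → T < T₀ →
        ∃ L : ℝ, Filter.Tendsto (fun ν : ℝ => g ν T) (nhdsWithin (0:ℝ) (Set.Ioi 0)) (nhds L)) →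
      ∀ T : ℝ, 0 < T →
        ∃ L : ℝ, Filter.Tendsto (fun ν : ℝ => g ν T) (nhdsWithin (0:ℝ) (Set.Ioi 0)) (nhds L)) := by
  intro h
  have hb : ∀ a b : ℝ, 0 < a → a < b → ∃ C : ℝ, 0 < C ∧ ∀ ν : ℝ, 0 < ν → ν ≤ 1 →
      ∀ k : ℕ, 1 ≤ k → ∀ T ∈ Set.Icc a b,
        |iteratedDeriv k (fun T => Real.sin ν⁻¹ • stepFun T) T| ≤ C ^ (k + 1) * (k.factorial : ℝ) := by
    intro a b _ _
    refine ⟨1, one_pos, fun ν _ _ k hk T _ => ?_⟩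
    rw [iteratedDeriv_fun_const_smul_field, iteratedDeriv_stepFun hk, smul_zero, abs_zero]
    positivity
  have hc : ∀ T : ℝ, 0 < T → T < 1 →
      ∃ L : ℝ, Tendsto (fun ν : ℝ => Real.sin ν⁻¹ • stepFun T) (𝓝[>] 0) (𝓝 L) := by
    intro T _ hT1
    refine ⟨0, ?_⟩
    have : (fun ν : ℝ => Real.sin ν⁻¹ • stepFun T) = fun _ => 0 := by
      funext ν; simp [stepFun, hT1.le]
    rw [this]
    exact tendsto_const_nhds
  obtain ⟨L, hL⟩ := h (fun ν T => Real.sin ν⁻¹ • stepFun T) 1 one_pos hb hc 2 two_pos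
  have e : (fun ν : ℝ => Real.sin ν⁻¹ • stepFun 2) = fun ν => Real.sin ν⁻¹ := by
    funext ν
    have : stepFun 2 = 1 := by norm_num [stepFun]
    rw [this, smul_eq_mul, mul_one]
  rw [e] at hL
  exact not_tendsto_sin_inv ⟨L, hL⟩

end Summit.AtomisticToContinuum.FouriersLaw.Cruxes.GreenKuboContinuation.Drefute

end
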